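import Summits.ValiantsHypothesis.ValiantsHypothesis.Theorems.LacunarySymmetroidMatrixDescartesPivotRankOneCriticalWindowsSideCount

/-!
# `MatrixDescartes` census — rank-one `(2,K)₁`: THE ONE-SIDED PIPELINE
# (all letters on one side of the pivot letter ⇒ `Z₊(det F) ≤ 1 + C_side` — the form in which every per-side law becomes a root count)

HONEST FRAMING.  Object-search cell `pub-symmetroid`, seat `val-sym-mdr-p1` (generation 25); helper file `--supports` the crux item
stmt-ValiantsHypothesis-18050 (`Theses.LacunarySymmetroid.MatrixDescartes`, OPEN, on HOLD) with NO closure claim.  The cheap corollary of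
`…CriticalWindowsSideCount.rankOne_card_posRoots_le_max_add_one` (`Z₊ ≤ 1 + max(C_L, C_R)`) recorded for the successors of this lineage:
if every letter other than the pivot letter lies to the RIGHT of it (`tₚ < tₘ`), the far side carries NO critical point of the window profile
at all — at a critical point `(x, T)` with `0 < T < tₚ` every term of the first critical equation `∑ₘ wₘ x^{dₘ} (T² − tₘ²) = 0` is negative —
so the left budget is `0` and **`Z₊(f) ≤ C_R + 1`** (`rankOne_card_posRoots_le_add_one_of_letters_right`); mirror statement for letters to
the LEFT (`rankOne_card_posRoots_le_add_one_of_letters_left`); census currency `pivotPosRoots_le_add_one_of_letters_right/left`.  This is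
the interface through which a per-side critical-direction law (the lone-letter law of generation 24, the parallel two-letter law of this
generation, any future `n`-letter law) is read as a root count of the one-sided `1 | K−1` row.  A COUNTING INSTRUMENT for one sub-row;
nothing here bears on `MatrixDescartes` in its window, on `DoorA26` / `DoorA34`, registers / ζ, or `VP ≠ VNP`.

[folklore] sign of a sum (`Finset.sum_pos`); tree theorems named above.  No definitions, no named facts.
-/

-- `Summit.ValiantsHypothesis.ValiantsHypothesis.…` repeats a component by the D-0017 layout
-- (single-conjunct summit), which the `dupNamespace` linter flags; the name is mandated.
set_option linter.dupNamespace false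

namespace Summit.ValiantsHypothesis.ValiantsHypothesis.Theorems.LacunarySymmetroidMatrixDescartes.Pivot.CriticalWindows.OneSidedPipeline

open Polynomial Finset Set Matrix
open scoped BigOperators
open Summit.ValiantsHypothesis.ValiantsHypothesis.Theorems.LacunarySymmetroidMatrixDescartes.Pivot (pivotPosRoots)
open Summit.ValiantsHypothesis.ValiantsHypothesis.Theorems.LacunarySymmetroidMatrixDescartes.Pivot.CriticalWindows.RootCount
open Summit.ValiantsHypothesis.ValiantsHypothesis.Theorems.LacunarySymmetroidMatrixDescartes.Pivot.CriticalWindows.SideCount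
  (rankOne_card_posRoots_le_max_add_one pivotPosRoots_le_max_add_one)

/-- **NO FAR-SIDE CRITICAL POINT WHEN ALL LETTERS ARE ON THE RIGHT.**  Positive weights, `p ∈ s`, every other letter strictly to the right of
the pivot letter (`tₚ < tₘ`); then no `x > 0` carries a critical point `(x, T)` with `0 < T < tₚ`: the first critical equation
`∑ₘ wₘ x^{dₘ}(T² − tₘ²) = 0` has every term negative. [folklore] -/
theorem no_critical_left_of_letters_right {ι : Type*} (s : Finset ι) (w t : ι → ℝ) (d : ι → ℕ) (p : ι) (hp : p ∈ s)
    (hw : ∀ m ∈ s, 0 < w m) (hright : ∀ m ∈ s, m ≠ p → t p < t m) {x T : ℝ} (hx : 0 < x) (hT : 0 < T)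
    (hTp : T < t p) (h1 : ∑ m ∈ s, w m * x ^ d m * (T ^ 2 - t m ^ 2) = 0) : False := by
  have hlt : ∀ m ∈ s, T < t m := by
    intro m hm
    by_cases hmp : m = p
    · rw [hmp]; exact hTp
    · exact hTp.trans (hright m hm hmp)
  have hpos : 0 < ∑ m ∈ s, w m * x ^ d m * (t m ^ 2 - T ^ 2) := by
    apply Finset.sum_pos _ ⟨p, hp⟩
    intro m hm
    have hTm : T ^ 2 < t m ^ 2 := by
      have := hlt m hm
      nlinarith
    exact mul_pos (mul_pos (hw m hm) (pow_pos hx _)) (by linarith)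
  have hneg : ∑ m ∈ s, w m * x ^ d m * (t m ^ 2 - T ^ 2) = -∑ m ∈ s, w m * x ^ d m * (T ^ 2 - t m ^ 2) := by
    rw [← Finset.sum_neg_distrib]
    refine Finset.sum_congr rfl fun m _ => by ring
  rw [hneg, h1, neg_zero] at hpos
  exact lt_irrefl _ hpos

/-- **NO NEAR-SIDE-BEYOND CRITICAL POINT WHEN ALL LETTERS ARE ON THE LEFT.**  Mirror statement: every other letter strictly to the left of
the pivot letter (`tₘ < tₚ`), positive positions; then no `x > 0` carries a critical point `(x, T)` with `tₚ < T`: every term of the first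
critical equation is positive. [folklore] -/
theorem no_critical_right_of_letters_left {ι : Type*} (s : Finset ι) (w t : ι → ℝ) (d : ι → ℕ) (p : ι) (hp : p ∈ s)
    (hw : ∀ m ∈ s, 0 < w m) (ht : ∀ m ∈ s, 0 < t m) (hleft : ∀ m ∈ s, m ≠ p → t m < t p) {x T : ℝ} (hx : 0 < x)
    (hTp : t p < T) (h1 : ∑ m ∈ s, w m * x ^ d m * (T ^ 2 - t m ^ 2) = 0) : False := by
  have hlt : ∀ m ∈ s, t m < T := by
    intro m hm
    by_cases hmp : m = p
    · rw [hmp]; exact hTp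
    · exact (hleft m hm hmp).trans hTp
  have hpos : 0 < ∑ m ∈ s, w m * x ^ d m * (T ^ 2 - t m ^ 2) := by
    apply Finset.sum_pos _ ⟨p, hp⟩
    intro m hm
    have htm : 0 < t m := ht m hm
    have hTm : t m ^ 2 < T ^ 2 := by
      have := hlt m hm
      nlinarith
    exact mul_pos (mul_pos (hw m hm) (pow_pos hx _)) (by linarith)
  rw [h1] at hpos
  exact lt_irrefl _ hpos

/-- **THE ONE-SIDED PIPELINE (letters to the right).**  In the setting of `SideCount.rankOne_card_posRoots_le_max_add_one` (positive weights
and positions, `dₚ < e < dₘ` off the pivot letter, not all letters parallel to the pivot letter, `f` with positive roots the positive zeros of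
`A C − (U + x^e)²`), if every other letter lies strictly to the RIGHT of the pivot letter and every finite set of scales carrying RIGHT
critical points (`tₚ < T`) has at most `C` elements, then **`Z₊(f) ≤ C + 1`**. [this file] -/
theorem rankOne_card_posRoots_le_add_one_of_letters_right {ι : Type*} (s : Finset ι) (w t : ι → ℝ) (d : ι → ℕ) (e : ℕ) (p : ι)
    (hp : p ∈ s) (hw : ∀ m ∈ s, 0 < w m) (ht : ∀ m ∈ s, 0 < t m) (hdp : d p < e) (hdm : ∀ m ∈ s, m ≠ p → e < d m)
    (hnp : ∃ m ∈ s, t m ≠ t p) (hright : ∀ m ∈ s, m ≠ p → t p < t m) (f : ℝ[X])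
    (hf : ∀ x, 0 < x → (f.IsRoot x ↔ (∑ k ∈ s, w k * x ^ d k) * (∑ k ∈ s, w k * t k ^ 2 * x ^ d k)
      - ((∑ k ∈ s, w k * t k * x ^ d k) + x ^ e) ^ 2 = 0))
    (C : ℕ)
    (hR : ∀ S : Finset ℝ, (∀ x ∈ S, 0 < x ∧ ∃ T, t p < T ∧
        (∑ m ∈ s, w m * x ^ d m * (T ^ 2 - t m ^ 2) = 0) ∧
        (∑ m ∈ s, ((d m : ℝ) - e) * (w m * x ^ d m) * (T - t m) ^ 2 = 0)) → S.card ≤ C) :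
    (f.roots.toFinset.filter (fun t => 0 < t)).card ≤ C + 1 := by
  have h := rankOne_card_posRoots_le_max_add_one s w t d e p hp hw ht hdp hdm hnp f hf 0 C ?_ hR
  · simpa using h
  · intro S hS
    have hSe : S = ∅ := by
      refine Finset.eq_empty_of_forall_notMem fun x hx => ?_
      obtain ⟨hx, T, hT, hTp, h1, -⟩ := hS x hx
      exact no_critical_left_of_letters_right s w t d p hp hw hright hx hT hTp h1
    simp [hSe]

/-- **THE ONE-SIDED PIPELINE (letters to the left).**  Same setting; if every other letter lies strictly to the LEFT of the pivot letter and
every finite set of scales carrying LEFT critical points (`0 < T < tₚ`) has at most `C` elements, then **`Z₊(f) ≤ C + 1`**. [this file] -/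
theorem rankOne_card_posRoots_le_add_one_of_letters_left {ι : Type*} (s : Finset ι) (w t : ι → ℝ) (d : ι → ℕ) (e : ℕ) (p : ι)
    (hp : p ∈ s) (hw : ∀ m ∈ s, 0 < w m) (ht : ∀ m ∈ s, 0 < t m) (hdp : d p < e) (hdm : ∀ m ∈ s, m ≠ p → e < d m)
    (hnp : ∃ m ∈ s, t m ≠ t p) (hleft : ∀ m ∈ s, m ≠ p → t m < t p) (f : ℝ[X])
    (hf : ∀ x, 0 < x → (f.IsRoot x ↔ (∑ k ∈ s, w k * x ^ d k) * (∑ k ∈ s, w k * t k ^ 2 * x ^ d k)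
      - ((∑ k ∈ s, w k * t k * x ^ d k) + x ^ e) ^ 2 = 0))
    (C : ℕ)
    (hL : ∀ S : Finset ℝ, (∀ x ∈ S, 0 < x ∧ ∃ T, 0 < T ∧ T < t p ∧
        (∑ m ∈ s, w m * x ^ d m * (T ^ 2 - t m ^ 2) = 0) ∧
        (∑ m ∈ s, ((d m : ℝ) - e) * (w m * x ^ d m) * (T - t m) ^ 2 = 0)) → S.card ≤ C) :
    (f.roots.toFinset.filter (fun t => 0 < t)).card ≤ C + 1 := by
  have h := rankOne_card_posRoots_le_max_add_one s w t d e p hp hw ht hdp hdm hnp f hf C 0 hL ?_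
  · simpa using h
  · intro S hS
    have hSe : S = ∅ := by
      refine Finset.eq_empty_of_forall_notMem fun x hx => ?_
      obtain ⟨hx, T, hTp, h1, -⟩ := hS x hx
      exact no_critical_right_of_letters_left s w t d p hp hw ht hleft hx hTp h1
    simp [hSe]

/-! ## Census currency -/

/-- **THE ONE-SIDED PIPELINE IN CENSUS CURRENCY (letters to the right)**: `Fin K` rank-one letters in the hyperbolic normal form, all other
letters strictly to the right of the pivot letter, right budget `C` ⇒ `pivotPosRoots e d J P ≤ C + 1`. [this file] -/
theorem pivotPosRoots_le_add_one_of_letters_right (K e : ℕ) (d : Fin K → ℕ) (w t : Fin K → ℝ) (p : Fin K)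
    (hw : ∀ m, 0 < w m) (ht : ∀ m, 0 < t m) (hdp : d p < e) (hdm : ∀ m, m ≠ p → e < d m) (hnp : ∃ m, t m ≠ t p)
    (hright : ∀ m, m ≠ p → t p < t m) (C : ℕ)
    (hR : ∀ S : Finset ℝ, (∀ x ∈ S, 0 < x ∧ ∃ T, t p < T ∧
        (∑ m, w m * x ^ d m * (T ^ 2 - t m ^ 2) = 0) ∧
        (∑ m, ((d m : ℝ) - e) * (w m * x ^ d m) * (T - t m) ^ 2 = 0)) → S.card ≤ C) :
    pivotPosRoots e d (!![(0 : ℝ), 1; 1, 0]) (fun k => w k • vecMulVec ![1, t k] ![1, t k]) ≤ C + 1 := by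
  have h := pivotPosRoots_le_max_add_one K e d w t p hw ht hdp hdm hnp 0 C ?_ hR
  · simpa using h
  · intro S hS
    have hSe : S = ∅ := by
      refine Finset.eq_empty_of_forall_notMem fun x hx => ?_
      obtain ⟨hx, T, hT, hTp, h1, -⟩ := hS x hx
      exact no_critical_left_of_letters_right (Finset.univ : Finset (Fin K)) w t d p (Finset.mem_univ p) (fun m _ => hw m)
        (fun m _ hm => hright m hm) hx hT hTp h1
    simp [hSe]

/-- **THE ONE-SIDED PIPELINE IN CENSUS CURRENCY (letters to the left)**: all other letters strictly to the left of the pivot letter, left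
budget `C` ⇒ `pivotPosRoots e d J P ≤ C + 1`. [this file] -/
theorem pivotPosRoots_le_add_one_of_letters_left (K e : ℕ) (d : Fin K → ℕ) (w t : Fin K → ℝ) (p : Fin K)
    (hw : ∀ m, 0 < w m) (ht : ∀ m, 0 < t m) (hdp : d p < e) (hdm : ∀ m, m ≠ p → e < d m) (hnp : ∃ m, t m ≠ t p)
    (hleft : ∀ m, m ≠ p → t m < t p) (C : ℕ)
    (hL : ∀ S : Finset ℝ, (∀ x ∈ S, 0 < x ∧ ∃ T, 0 < T ∧ T < t p ∧
        (∑ m, w m * x ^ d m * (T ^ 2 - t m ^ 2) = 0) ∧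
        (∑ m, ((d m : ℝ) - e) * (w m * x ^ d m) * (T - t m) ^ 2 = 0)) → S.card ≤ C) :
    pivotPosRoots e d (!![(0 : ℝ), 1; 1, 0]) (fun k => w k • vecMulVec ![1, t k] ![1, t k]) ≤ C + 1 := by
  have h := pivotPosRoots_le_max_add_one K e d w t p hw ht hdp hdm hnp C 0 hL ?_
  · simpa using h
  · intro S hS
    have hSe : S = ∅ := by
      refine Finset.eq_empty_of_forall_notMem fun x hx => ?_
      obtain ⟨hx, T, hTp, h1, -⟩ := hS x hx
      exact no_critical_right_of_letters_left (Finset.univ : Finset (Fin K)) w t d p (Finset.mem_univ p) (fun m _ => hw m)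
        (fun m _ => ht m) (fun m _ hm => hleft m hm) hx hTp h1
    simp [hSe]

end Summit.ValiantsHypothesis.ValiantsHypothesis.Theorems.LacunarySymmetroidMatrixDescartes.Pivot.CriticalWindows.OneSidedPipeline
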